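import Literature.Computability.Cryptography.BLPRSQuality
import Mathlib.Data.Matrix.Mul
import HarnessLib

/-!
# The quality bound of BLPRS 2013, Def. 4.5 as the real-matrix bound `‖U'y‖² ≤ ξ²‖y‖²` on `U` minus its first column

Topic `Computability/Cryptography`, grouping namespace `BLPRS2013`; sequel of `BLPRSQuality.lean` (Def. 4.5
`HasQuality`, Claim 4.6 `hasQuality_two_binary`). Proved glue (no named fact) towards
`Literature.Computability.Cryptography.blprs_gapSVP_sqrt_dim_to_lwe_classical` (pqc.S21), Lemma 4.7: the
Gaussian step "`Ue + f` is spherical" (`ContinuousGaussianMultivariate.lean` /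
`GaussianLinearCompensation.lean`) takes the largest-singular-value bound of `U'` (`U` with its leftmost
column removed) in the form `∀ y, (U'y) ⬝ (U'y) ≤ ξ² (y ⬝ y)` for the REAL matrix `U'`; `HasQuality`
states it as `∑ᵢ (∑ⱼ Uᵢⱼ xⱼ)² ≤ ξ² ∑ⱼ xⱼ²` for real `x` with `x₀ = 0` and the INTEGER matrix `U`.

## Results

* `dropFirstCol U` — `U' : ℝ^{(k+1) × k}`, `U'ᵢⱼ = U_{i, j+1}` cast to `ℝ`;
* `dropFirstCol_mulVec` — `(U' y)ᵢ = ∑ⱼ Uᵢⱼ xⱼ` for `x = (0 | y)`;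
* **`HasQuality.dropFirstCol_bound`** — from `HasQuality ξ 𝒵` and `z ∈ 𝒵`: a unimodular `U` with columns
  `j ≠ 0` orthogonal to `z` and `∀ y, (U'y) ⬝ (U'y) ≤ ξ² (y ⬝ y)`.

## References

* Z. Brakerski, A. Langlois, C. Peikert, O. Regev, D. Stehlé, *Classical hardness of learning with errors*,
  STOC 2013; arXiv:1306.0281, Def. 4.5 and the proof of Lemma 4.7.
-/

namespace Literature.Computability.Cryptography

namespace BLPRS2013

open Matrix Finset

variable {k : ℕ}

/-- `U'`: the integer matrix `U ∈ ℤ^{(k+1)×(k+1)}` without its leftmost column (index `0`), read in `ℝ`.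
[cite: BrakerskiEtAl2013, Def. 4.5 ("the matrix obtained from U by removing its leftmost column")] -/
def dropFirstCol (U : Matrix (Fin (k + 1)) (Fin (k + 1)) ℤ) : Matrix (Fin (k + 1)) (Fin k) ℝ :=
  fun i j => (U i j.succ : ℝ)

/-- `(U' y)ᵢ = ∑ⱼ Uᵢⱼ xⱼ` with `x = (0 | y)`. [folklore] -/
theorem dropFirstCol_mulVec (U : Matrix (Fin (k + 1)) (Fin (k + 1)) ℤ) (y : Fin k → ℝ) (i : Fin (k + 1)) :
    (dropFirstCol U *ᵥ y) i = ∑ j, (U i j : ℝ) * (Fin.cons 0 y : Fin (k + 1) → ℝ) j := by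
  rw [Fin.sum_univ_succ, Fin.cons_zero, mul_zero, zero_add]
  simp only [mulVec, dotProduct, dropFirstCol, Fin.cons_succ]

/-- **The quality bound in real-matrix form.** If `𝒵` has quality `ξ` then every `z ∈ 𝒵` has a unimodular
`U` whose columns `j ≠ 0` are orthogonal to `z` and whose `U'` satisfies `(U'y) ⬝ (U'y) ≤ ξ² (y ⬝ y)` for all
real `y` (take `x = (0 | y)` in Def. 4.5). [cite: BrakerskiEtAl2013, Def. 4.5 and Lemma 4.7 (proof)] -/
theorem HasQuality.dropFirstCol_bound {ξ : ℝ} {Z : Set (Fin (k + 1) → ℤ)} (hZ : HasQuality ξ Z)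
    {z : Fin (k + 1) → ℤ} (hz : z ∈ Z) :
    ∃ U : Matrix (Fin (k + 1)) (Fin (k + 1)) ℤ, IsUnit U.det ∧
      (∀ j : Fin (k + 1), j ≠ 0 → (fun i => U i j) ⬝ᵥ z = 0) ∧
      ∀ y : Fin k → ℝ, (dropFirstCol U *ᵥ y) ⬝ᵥ (dropFirstCol U *ᵥ y) ≤ ξ ^ 2 * (y ⬝ᵥ y) := by
  obtain ⟨U, hdet, horth, hbound⟩ := hZ z hz
  refine ⟨U, hdet, horth, fun y => ?_⟩
  have h := hbound (Fin.cons 0 y) (Fin.cons_zero _ _)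
  have hlhs : (dropFirstCol U *ᵥ y) ⬝ᵥ (dropFirstCol U *ᵥ y) =
      ∑ i, (∑ j, (U i j : ℝ) * (Fin.cons 0 y : Fin (k + 1) → ℝ) j) ^ 2 := by
    simp only [dotProduct, sq, dropFirstCol_mulVec]
  have hrhs : (y ⬝ᵥ y) = ∑ j, (Fin.cons 0 y : Fin (k + 1) → ℝ) j ^ 2 := by
    rw [Fin.sum_univ_succ, Fin.cons_zero]
    simp only [dotProduct, sq, Fin.cons_succ, mul_zero, zero_add]
  rw [hlhs, hrhs]
  exact h

end BLPRS2013

end Literature.Computability.Cryptography
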